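import Mathlib.RingTheory.Kaehler.Basic
import Mathlib.RingTheory.Derivation.Basic
import Mathlib.LinearAlgebra.Basis.Basic
import HarnessLib

/-!
# Bases of Kähler differentials from dual derivations

A generic criterion producing an `R`-basis of the module of ABSOLUTE Kähler differentials
`Ω[R⁄ℤ]` of a commutative ring `R` from a family `t : ι → R` of elements together with a
family of "dual" derivations `δ : ι → Derivation ℤ R R`, `δ i (t j) = δ_{ij}`:

* `linearIndependent_D_of_derivations` — dual derivations force the differentials `d(t i)` to
  be `R`-linearly independent (apply the `R`-linear functional
  `(δ i).liftKaehlerDifferential : Ω[R⁄ℤ] →ₗ[R] R` to a vanishing combination);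
* `basisKaehlerOfDerivations` — if moreover the `d(t i)` span `Ω[R⁄ℤ]`, they form an `R`-basis
  (`Module.Basis.mk`), with `basisKaehlerOfDerivations_apply : b i = d(t i)` and the coordinate
  formula `basisKaehlerOfDerivations_repr_apply : b.repr ω i = (δ i).liftKaehlerDifferential ω`
  (so the `i`-th coordinate of `dx` is the "partial derivative" `δ i x`,
  `basisKaehlerOfDerivations_repr_D`);
* `KaehlerDifferential.eq_top_of_forall_D_mem` — the spanning criterion: a submodule of `Ω[R⁄ℤ]`
  containing every `dx` is everything (`KaehlerDifferential.span_range_derivation`);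
* `Derivation.leibniz_finset_prod`, `Derivation.leibniz_finset_prod_pow` — the Leibniz rule for
  finite products (of powers) for an arbitrary derivation `Derivation A B M`, and the corollaries
  `D_prod_pow_eq_sum`, `D_prod_pow_mem_span` expressing `d(∏ i, t i ^ e i)` as an explicit
  `R`-combination of the `d(t i)`.

This is the linear-algebra skeleton of the classical statement that a `p`-basis (more generally a
differential basis) of a ring gives a basis of its differentials (Matsumura, *Commutative Ring
Theory*, §26, Thm. 26.5; §30), kept free of any characteristic-`p` input: the `p`-basis file
`PBasis.lean` supplies the dual derivations and the spanning, this file turns them into a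
`Module.Basis`.  Everything is proved; there are no named facts. [folklore]
-/

noncomputable section

namespace Literature.NumberTheory.GaloisCohomology

universe u v w w'

/-! ## Leibniz rule for finite products -/

section Leibniz

variable {A : Type u} {B : Type v} {M : Type w} [CommSemiring A] [CommSemiring B] [Algebra A B]
  [AddCommMonoid M] [Module A M] [Module B M] {ι : Type w'}

/-- **Leibniz rule for a finite product**, for an arbitrary derivation `D : B → M` over `A`:
`D (∏_{i ∈ s} f i) = ∑_{i ∈ s} (∏_{j ∈ s, j ≠ i} f j) • D (f i)`.
(Dot-notation extension of Mathlib's `Derivation`, declared in this file's namespace; the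
`M = B` special case with `*` in place of `•` is `Derivation.apply_finset_prod` of
`Literature/AlgebraicGeometry/Resolution/FormalBranchesJacobian.lean`, not imported here.)
[folklore] -/
theorem Derivation.leibniz_finset_prod [DecidableEq ι] (D : Derivation A B M) (s : Finset ι)
    (f : ι → B) : D (∏ i ∈ s, f i) = ∑ i ∈ s, (∏ j ∈ s.erase i, f j) • D (f i) := by
  induction s using Finset.induction_on with
  | empty => simp
  | insert a s ha ih =>
    rw [Finset.prod_insert ha, Derivation.leibniz, ih, Finset.sum_insert ha,
      Finset.erase_insert ha, add_comm, Finset.smul_sum]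
    congr 1
    refine Finset.sum_congr rfl fun i hi => ?_
    rw [Finset.erase_insert_of_ne (by rintro rfl; exact ha hi),
      Finset.prod_insert (fun h => ha (Finset.mem_of_mem_erase h)), mul_smul]

/-- **Leibniz rule for a finite product of powers**: for a derivation `D : B → M` over `A`,
`D (∏_{i ∈ s} f i ^ e i) = ∑_{i ∈ s} (e i · f i ^ (e i - 1) · ∏_{j ∈ s, j ≠ i} f j ^ e j) • D (f i)`.
The truncated subtraction `e i - 1` is harmless: for `e i = 0` the coefficient vanishes because of
the factor `(e i : B) = 0` (this is Mathlib's normal form `Derivation.leibniz_pow`). [folklore] -/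
theorem Derivation.leibniz_finset_prod_pow [DecidableEq ι] (D : Derivation A B M) (s : Finset ι)
    (f : ι → B) (e : ι → ℕ) :
    D (∏ i ∈ s, f i ^ e i) =
      ∑ i ∈ s, ((e i : B) * f i ^ (e i - 1) * ∏ j ∈ s.erase i, f j ^ e j) • D (f i) := by
  rw [Derivation.leibniz_finset_prod D s]
  refine Finset.sum_congr rfl fun i _ => ?_
  rw [D.leibniz_pow, ← Nat.cast_smul_eq_nsmul B, smul_smul, smul_smul]
  congr 1
  ring

end Leibniz

/-! ## Bases of `Ω[R⁄ℤ]` from dual derivations -/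

section Basis

open _root_.KaehlerDifferential (D)

variable {R : Type u} [CommRing R] {ι : Type v} [DecidableEq ι]

/-- **Dual derivations give linear independence of differentials.** If `δ i (t j) = δ_{ij}` for
derivations `δ i : R → R`, then the differentials `d(t i) ∈ Ω[R⁄ℤ]` are `R`-linearly independent:
applying the `R`-linear functional `(δ i).liftKaehlerDifferential` (which sends `dx ↦ δ i x`) to a
relation `∑ g j • d(t j) = 0` gives `g i = 0`. [folklore] -/
theorem linearIndependent_D_of_derivations (t : ι → R) (δ : ι → Derivation ℤ R R)
    (hδ : ∀ i j, δ i (t j) = if i = j then 1 else 0) :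
    LinearIndependent R (fun i => D ℤ R (t i)) := by
  rw [linearIndependent_iff']
  intro s g hg i hi
  have h := congrArg (δ i).liftKaehlerDifferential hg
  rw [map_sum, map_zero] at h
  simp_rw [map_smul, Derivation.liftKaehlerDifferential_comp_D, hδ, smul_eq_mul, mul_ite, mul_one,
    mul_zero, Finset.sum_ite_eq, if_pos hi] at h
  exact h

/-- **Dual derivations + spanning ⇒ basis.** If `δ i (t j) = δ_{ij}` and the differentials
`d(t i)` span `Ω[R⁄ℤ]` over `R`, then `i ↦ d(t i)` is an `R`-basis of `Ω[R⁄ℤ]`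
(`Module.Basis.mk` on `linearIndependent_D_of_derivations`). [folklore] -/
def basisKaehlerOfDerivations (t : ι → R) (δ : ι → Derivation ℤ R R)
    (hδ : ∀ i j, δ i (t j) = if i = j then 1 else 0)
    (hspan : Submodule.span R (Set.range fun i => D ℤ R (t i)) = ⊤) : Module.Basis ι R (Ω[R⁄ℤ]) :=
  Module.Basis.mk (linearIndependent_D_of_derivations t δ hδ) hspan.ge

variable (t : ι → R) (δ : ι → Derivation ℤ R R) (hδ : ∀ i j, δ i (t j) = if i = j then 1 else 0)
  (hspan : Submodule.span R (Set.range fun i => D ℤ R (t i)) = ⊤)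

/-- The `i`-th vector of the basis `basisKaehlerOfDerivations` is `d(t i)`. [folklore] -/
@[simp] theorem basisKaehlerOfDerivations_apply (i : ι) :
    basisKaehlerOfDerivations t δ hδ hspan i = D ℤ R (t i) :=
  Module.Basis.mk_apply _ _ i

/-- The basis `basisKaehlerOfDerivations`, as a function, is `i ↦ d(t i)`. [folklore] -/
theorem coe_basisKaehlerOfDerivations :
    ⇑(basisKaehlerOfDerivations t δ hδ hspan) = fun i => D ℤ R (t i) :=
  Module.Basis.coe_mk _ _

/-- **Coordinates are computed by the lifted derivations**: the `i`-th coordinate of `ω ∈ Ω[R⁄ℤ]`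
in the basis `(d(t i))_i` is `(δ i).liftKaehlerDifferential ω` — both sides are `R`-linear in `ω`
and agree on the basis vectors `d(t j)` (value `δ_{ij}`). [folklore] -/
theorem basisKaehlerOfDerivations_repr_apply (ω : Ω[R⁄ℤ]) (i : ι) :
    (basisKaehlerOfDerivations t δ hδ hspan).repr ω i = (δ i).liftKaehlerDifferential ω := by
  suffices h : (Finsupp.lapply i).comp (basisKaehlerOfDerivations t δ hδ hspan).repr.toLinearMap =
      (δ i).liftKaehlerDifferential from LinearMap.congr_fun h ω
  refine (basisKaehlerOfDerivations t δ hδ hspan).ext fun j => ?_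
  rw [LinearMap.comp_apply, LinearEquiv.coe_coe, Module.Basis.repr_self, Finsupp.lapply_apply,
    basisKaehlerOfDerivations_apply, Derivation.liftKaehlerDifferential_comp_D, hδ,
    Finsupp.single_eq_pi_single, Pi.single_apply]

/-- In particular the `i`-th coordinate of `dx` in the basis `(d(t i))_i` is the "partial
derivative" `δ i x`. [folklore] -/
@[simp] theorem basisKaehlerOfDerivations_repr_D (x : R) (i : ι) :
    (basisKaehlerOfDerivations t δ hδ hspan).repr (D ℤ R x) i = δ i x := by
  rw [basisKaehlerOfDerivations_repr_apply, Derivation.liftKaehlerDifferential_comp_D]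

include hδ hspan in
/-- `dx = ∑ i, δ i x • d(t i)` for a finite dual system: the expansion of a differential in the
basis `basisKaehlerOfDerivations`. [folklore] -/
theorem sum_apply_smul_D_eq [Fintype ι] (x : R) :
    ∑ i, δ i x • D ℤ R (t i) = D ℤ R x := by
  conv_rhs => rw [← (basisKaehlerOfDerivations t δ hδ hspan).sum_repr (D ℤ R x)]
  exact Finset.sum_congr rfl fun i _ => by
    rw [basisKaehlerOfDerivations_repr_D, basisKaehlerOfDerivations_apply]

end Basis

/-! ## The spanning criterion and products of powers -/

section Span

open _root_.KaehlerDifferential (D)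

variable {R : Type u} [CommRing R] {ι : Type v}

/-- **Spanning criterion.** A submodule of `Ω[R⁄ℤ]` containing `dx` for every `x : R` is all of
`Ω[R⁄ℤ]`, because `Ω[R⁄ℤ]` is spanned over `R` by the `dx`
(`KaehlerDifferential.span_range_derivation`). (Declared in this file's namespace, not in
Mathlib's `KaehlerDifferential`.) [folklore] -/
theorem KaehlerDifferential.eq_top_of_forall_D_mem (N : Submodule R (Ω[R⁄ℤ]))
    (h : ∀ x : R, D ℤ R x ∈ N) : N = ⊤ := by
  rw [eq_top_iff, ← KaehlerDifferential.span_range_derivation, Submodule.span_le]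
  rintro _ ⟨x, rfl⟩
  exact h x

/-- **Spanning criterion for a family.** If every `dx` lies in the `R`-span of the `d(t i)`, then
the `d(t i)` span `Ω[R⁄ℤ]` (the hypothesis `hspan` of `basisKaehlerOfDerivations`). [folklore] -/
theorem span_range_D_eq_top_of_forall_mem (t : ι → R)
    (h : ∀ x : R, D ℤ R x ∈ Submodule.span R (Set.range fun i => D ℤ R (t i))) :
    Submodule.span R (Set.range fun i => D ℤ R (t i)) = ⊤ :=
  KaehlerDifferential.eq_top_of_forall_D_mem _ h

/-- **`d` of a product of powers**: for `t : ι → R` (`ι` finite) and exponents `e : ι → ℕ`,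
`d(∏ i, t i ^ e i) = ∑ i (e i · t i ^ (e i - 1) · ∏_{j ≠ i} t j ^ e j) • d(t i)` in `Ω[R⁄ℤ]` — an
explicit `R`-combination of the `d(t i)` (`Derivation.leibniz_finset_prod_pow` for `d`; for
`e i = 0` the `i`-th coefficient is `0`). [folklore] -/
theorem D_prod_pow_eq_sum [Fintype ι] [DecidableEq ι] (t : ι → R) (e : ι → ℕ) :
    D ℤ R (∏ i, t i ^ e i) =
      ∑ i, ((e i : R) * t i ^ (e i - 1) * ∏ j ∈ Finset.univ.erase i, t j ^ e j) • D ℤ R (t i) :=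
  Derivation.leibniz_finset_prod_pow (D ℤ R) Finset.univ t e

/-- **`d` of a product of powers lies in the span of the `d(t i)`**:
`d(∏ i, t i ^ e i) ∈ ∑ i R • d(t i)`. [folklore] -/
theorem D_prod_pow_mem_span [Fintype ι] (t : ι → R) (e : ι → ℕ) :
    D ℤ R (∏ i, t i ^ e i) ∈ Submodule.span R (Set.range fun i => D ℤ R (t i)) := by
  classical
  rw [D_prod_pow_eq_sum]
  exact Submodule.sum_mem _ fun i _ => Submodule.smul_mem _ _ (Submodule.subset_span ⟨i, rfl⟩)

end Span

end Literature.NumberTheory.GaloisCohomology
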